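import Literature.MathematicalPhysics.QuantumFieldTheory.Balaban1983to89.B9Thm313WholeDvFromDds
import Literature.MathematicalPhysics.QuantumFieldTheory.Balaban1983to89.B9GradViaDivLettersAtPinsL2

/-!
# `Balaban1983to89.B9Thm313WholeDvAtPins` — [B9] Theorems 3.12–3.13 (pp. 420–426): THE FIVE D_U-RIGHT LETTER FIELDS OF ROWS 20–21 AT THE N06
# CERTIFICATE'S PINS — `B9Thm313WholeDvFromDds` (the algebra) ∘ `B9GradViaDivLettersAtPins(L2)` (the kinematic letters at node00-def-Y's `DvcoKH ∕ DcoK`):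
# `Letters313Z.gD1 ∕ gD2`, `Letters313L2PZ.gDv ∕ dGDv`, `Letters313L2MZ.dGDvd` for every member, every `Reg335` configuration, from the DERIVED
# `Thm33G0DirR.e2d` ∕ `Thm33G0L2M.l2d, l4m` — NO kinematic binder left

T. Bałaban, *Propagators for lattice gauge theories in a background field*, Commun. Math. Phys. **99** (1985) 389–434
[`Balaban1985BackgroundPropagators`, "B9"]; [4] = T. Bałaban, *Propagators and renormalization transformations for lattice gauge
theories. II*, Commun. Math. Phys. **96** (1984) 223–250 [`Balaban1984PropagatorsII`].

statement-level skeleton of published theorems with citation tags; proofs where landed; nothing here is a claim about the Yang–Mills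
mass gap

THE POINT.  The consumable form for the knit (dag-n06-d): at a `B9Thm312Whole.Ops` record over a member `x` whose block maps and letters `Dv ∕ D` are pinned
to n06-d's carriers and def-Y's models (`hblk12 ∕ hblkY12 ∕ hblkW12 ∕ hDvco12 ∕ hDco12`) and with the direction letters pinned (`h𝔡Ad ∕ h𝔡As`), the five
displayed fields follow from the directional right entries of the DERIVED G₀-schemas (`hG0C`: `Thm33G0DirR.e2d`, `Thm33G0L2M.l2d ∕ l4m`) under `Reg335`
(contracting link variables) and the 1-faithfulness pin `hβ1`, with [4] Lemma 2.1's row sum (`RowSum`) and, for `gD2`, the member facts `Facts347`: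
★★ `gD1_pins`, ★★ `gD2_pins` (the G₀-layer's input `hgD12`), ★★ `gDv_pins`, ★★ `dGDvd_pins`, ★★ `dGDv_pins`.  Constants: `C_J = cR39 (trBasis N)·e^{δ_J·rJ}`,
`rJ = (d+1)(L+1)+2`, `|P| = d+1`.

HONEST SCOPE.  Kernel bookkeeping over landed modules (composition only); nothing of print's estimates asserted; COUNT-NEUTRAL; N06 NOT discharged; one
finite lattice at a time; nothing continuum, nothing about the mass gap.  Cell `pub-ymgap` (HUMAN RULING D-0062), Track A node N06 [B9], rows 20–21 (bundle
F7), seat `pub-ymgap-dag-n06-l` (g17), 2026-08-28.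
-/

noncomputable section

namespace Literature.MathematicalPhysics.QuantumFieldTheory.Balaban1983to89.B9Thm313WholeDvAtPins

open Node00 B6GlobalChartV1 B6KLevelCensusIndexV1 B9BackgroundsKLevelV1
open B6Geom246MultiLevelTorus (geomT)
open B6Ineq2142KLevelV1 (β)
open B6RandomWalkHom (HasMajorantHom)
open B11SectG (HasMaj RowSum)
open B9Thm34Ext (toB6)
open B9SectDL2Decay (BlockBd)
open B9Thm312Whole (cNorm GeoOK Ops)
open B9RWSums343to347Whole (Facts347)
open B9Thm39ReadingCoords (cR39 cR39_nonneg)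
open B9CoReadingCoords (XBK coordOpK cdBₗ cdsBₗ blkBK)
open B9CoReadingCoordsH (XHK)
open B9CoReadingCoordsS (XSK blkSK sIK)
open B9CoReadingCoordsTranspose (TrIdx trBasis)
open B9PinMembersKLevelV1 (MemberY geo9Y bg9Y)
open B7Prop2SpecialUnitary (specialUnitaryUnits)
open Node00.OpsYSectDCoords (DvcoKH)
open B9GradViaDivLettersAtPins (JcoKH rJ sliceProjK DvcoKH_eq_sum DcoK_eq_sum hasMaj_JcoKH_pins)
open B9GradViaDivLettersAtPinsL2 (blockBd_JcoKH_pins blockBd_sliceProjK)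
open B9Thm313WholeDvFromDds (gD1_of_e2d gD2_of_e2d gDv_l2_of_l2d dGDvd_l2_of_l4m dGDv_l2_of_l4m)
open scoped Matrix.Norms.L2Operator

variable {d ℓ : ℕ} {hd : 1 ≤ d + 1} {hL : Odd (ℓ + 1) ∧ 1 < ℓ + 1} {b₀ b₁ : ℝ} {Mstar : ℕ} {N : ℕ} [NeZero N]
variable [∀ x : MemberY d ℓ hd hL b₀ b₁ Mstar, Fintype (geo9Y x).Site]

omit [NeZero N] [∀ x : MemberY d ℓ hd hL b₀ b₁ Mstar, Fintype (geo9Y x).Site] in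
/-- `0 ≤ C_J = cR39·e^{δ·rJ}`. [cite: Balaban1985BackgroundPropagators, (3.48) p.398, bookkeeping] -/
theorem constJ_nonneg (δ : ℝ) : 0 ≤ cR39 (trBasis N) * Real.exp (δ * rJ d ℓ) := mul_nonneg (cR39_nonneg _) (Real.exp_nonneg _)

/-- ★★ **`Letters313Z.gD1` AT THE PINS** — G₀D_U : 𝔠_W⁽⁰⁾ → 𝔠⁽¹⁾ with `B₃ ≥ (d+1)·B₀·C_J·c`, `0 ≤ δ₃ ≤ δ₀`, `δ₃ + σ ≤ δ_J`, from the derived `Thm33G0DirR.e2d` at the pinned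
direction letters, every member, every `Reg335` configuration. [cite: Balaban1985BackgroundPropagators, Thm 3.3 (3.42) p.397, (3.133) p.422, (3.3) p.390, (3.35) p.396; Balaban1984PropagatorsII, (2.52)–(2.56) pp.232–233, Lemma 2.1 (2.61) p.234] -/
theorem gD1_pins (x : MemberY d ℓ hd hL b₀ b₁ Mstar) {bI : FBondY x.toKIdx → IBondY x.toKIdx}
    (hβ1 : ∀ f : FBondY x.toKIdx, (geomT x.D).dist (β x.hN x.D x.hk (bI f)) (blkV1 x.hN x.D f) ≤ 1) {c35 α₀ : ℝ}
    {U : (bg9Y (Matrix (Fin N) (Fin N) ℂ) (specialUnitaryUnits (Fin N)) x).Cfg}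
    (hU : (bg9Y (Matrix (Fin N) (Fin N) ℂ) (specialUnitaryUnits (Fin N)) x).Reg335 c35 α₀ U)
    {R₀ : ℝ} {H₀ : Prop} (hG : GeoOK (geo9Y x)) {σ c : ℝ} (hrow : RowSum (toB6 (geo9Y x) R₀ H₀) σ c)
    (𝔬 : Ops (geo9Y x) (bg9Y (Matrix (Fin N) (Fin N) ℂ) (specialUnitaryUnits (Fin N)) x) (XBK (TrIdx N) x.toKIdx) (XBK (TrIdx N) x.toKIdx)
      (XHK (TrIdx N) x.toKIdx) (XSK (TrIdx N) x.toKIdx))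
    (hblk : 𝔬.blk = blkBK x.toKIdx bI) (hblkW : 𝔬.blkW = blkSK x.toKIdx (sIK x.toKIdx bI))
    (hDv : 𝔬.Dv U = DvcoKH x.toKIdx (trBasis N) (bg9Y (Matrix (Fin N) (Fin N) ℂ) (specialUnitaryUnits (Fin N)) x) (fun U => U) U)
    {Dds : Fin (d + 1) → Module.End ℝ (XBK (TrIdx N) x.toKIdx → ℝ)}
    (hDds : Dds = fun μ => coordOpK (trBasis N) (fun _ : Fin (d + 1) => cdsBₗ x.toKIdx U μ))
    {B₀ δ₀ δJ B₃ δ₃ : ℝ} (hB₀ : 0 ≤ B₀) (hδJ : 0 ≤ δJ) (hδ₃ : 0 ≤ δ₃) (hδ₃0 : δ₃ ≤ δ₀) (hδ₃J : δ₃ + σ ≤ δJ)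
    (hB₃ : ((d : ℝ) + 1) * (B₀ * (cR39 (trBasis N) * Real.exp (δJ * rJ d ℓ)) * c) ≤ B₃)
    (he2d : ∀ μ, HasMajorantHom (g := toB6 (geo9Y x) R₀ H₀) 𝔬.blk 𝔬.blk (𝔬.G0 U ∘ₗ Dds μ)
      (fun (a b : (geo9Y x).Site) => B₀ * (geo9Y x).len a * Real.exp (-(δ₀ * (geo9Y x).dist a b)))) :
    HasMaj (cNorm R₀ H₀ 𝔬.blkW hG.lenle 0) (cNorm R₀ H₀ 𝔬.blk hG.lenle 1) (𝔬.G0 U ∘ₗ 𝔬.Dv U)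
      (fun a b => B₃ * Real.exp (-(δ₃ * (geo9Y x).dist a b))) := by
  have hDv' : 𝔬.Dv U = ∑ μ, Dds μ ∘ₗ JcoKH x.toKIdx (trBasis N) (bg9Y (Matrix (Fin N) (Fin N) ℂ) (specialUnitaryUnits (Fin N)) x) (fun U => U) μ U := by
    rw [hDv, hDds]
    exact DvcoKH_eq_sum x.toKIdx (trBasis N) (bg9Y (Matrix (Fin N) (Fin N) ℂ) (specialUnitaryUnits (Fin N)) x) (fun U => U) U
  have hJ : ∀ μ, HasMaj (cNorm R₀ H₀ 𝔬.blkW hG.lenle 0) (cNorm R₀ H₀ 𝔬.blk hG.lenle 0)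
      (JcoKH x.toKIdx (trBasis N) (bg9Y (Matrix (Fin N) (Fin N) ℂ) (specialUnitaryUnits (Fin N)) x) (fun U => U) μ U)
      (fun a b => cR39 (trBasis N) * Real.exp (δJ * rJ d ℓ) * Real.exp (-(δJ * (geo9Y x).dist a b))) := fun μ => by
    rw [hblk, hblkW]
    exact hasMaj_JcoKH_pins x hβ1 hU hδJ hG.lenle μ
  have hB₃' : (Fintype.card (Fin (d + 1)) : ℝ) * (B₀ * (cR39 (trBasis N) * Real.exp (δJ * rJ d ℓ)) * c) ≤ B₃ := by
    rw [Fintype.card_fin, Nat.cast_add, Nat.cast_one]; exact hB₃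
  exact gD1_of_e2d hG hrow hB₀ (constJ_nonneg δJ) hδ₃ hδ₃0 hδ₃J hB₃' hDv' he2d hJ

/-- ★★ **`Letters313Z.gD2` AT THE PINS = THE G₀-LAYER'S INPUT `hgD12`** — G₀D_U : 𝔠_W⁽¹⁾ → 𝔠⁽²⁾ with `B₃′ ≥ (d+1)·B₀·C_J·c·L₀`, `δ₃′ ≤ δ₃ − αδ` under the member
facts `Facts347`. [cite: Balaban1985BackgroundPropagators, Thm 3.3 (3.42) p.397, p.398 (remark after (3.47)), (3.133) p.422, (3.3) p.390; Balaban1984PropagatorsII, (2.52)–(2.56) pp.232–233, Lemma 2.1 (2.60)–(2.61) p.234] -/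
theorem gD2_pins (x : MemberY d ℓ hd hL b₀ b₁ Mstar) {bI : FBondY x.toKIdx → IBondY x.toKIdx}
    (hβ1 : ∀ f : FBondY x.toKIdx, (geomT x.D).dist (β x.hN x.D x.hk (bI f)) (blkV1 x.hN x.D f) ≤ 1) {c35 α₀ : ℝ}
    {U : (bg9Y (Matrix (Fin N) (Fin N) ℂ) (specialUnitaryUnits (Fin N)) x).Cfg}
    (hU : (bg9Y (Matrix (Fin N) (Fin N) ℂ) (specialUnitaryUnits (Fin N)) x).Reg335 c35 α₀ U)
    {R₀ : ℝ} {H₀ : Prop} (hG : GeoOK (geo9Y x)) {σ c : ℝ} (hrow : RowSum (toB6 (geo9Y x) R₀ H₀) σ c)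
    {dF : ℕ} {δF α L₀ : ℝ} (hF : Facts347 (geo9Y x) R₀ H₀ dF δF α L₀)
    (𝔬 : Ops (geo9Y x) (bg9Y (Matrix (Fin N) (Fin N) ℂ) (specialUnitaryUnits (Fin N)) x) (XBK (TrIdx N) x.toKIdx) (XBK (TrIdx N) x.toKIdx)
      (XHK (TrIdx N) x.toKIdx) (XSK (TrIdx N) x.toKIdx))
    (hblk : 𝔬.blk = blkBK x.toKIdx bI) (hblkW : 𝔬.blkW = blkSK x.toKIdx (sIK x.toKIdx bI))
    (hDv : 𝔬.Dv U = DvcoKH x.toKIdx (trBasis N) (bg9Y (Matrix (Fin N) (Fin N) ℂ) (specialUnitaryUnits (Fin N)) x) (fun U => U) U)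
    {Dds : Fin (d + 1) → Module.End ℝ (XBK (TrIdx N) x.toKIdx → ℝ)}
    (hDds : Dds = fun μ => coordOpK (trBasis N) (fun _ : Fin (d + 1) => cdsBₗ x.toKIdx U μ))
    {B₀ δ₀ δJ δ₃ B₃' δ₃' : ℝ} (hB₀ : 0 ≤ B₀) (hc : 0 ≤ c) (hδJ : 0 ≤ δJ) (hδ₃ : 0 ≤ δ₃) (hδ₃0 : δ₃ ≤ δ₀) (hδ₃J : δ₃ + σ ≤ δJ)
    (hB₃' : ((d : ℝ) + 1) * (B₀ * (cR39 (trBasis N) * Real.exp (δJ * rJ d ℓ)) * c) * L₀ ≤ B₃') (hδ₃' : δ₃' ≤ δ₃ - α * δF)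
    (he2d : ∀ μ, HasMajorantHom (g := toB6 (geo9Y x) R₀ H₀) 𝔬.blk 𝔬.blk (𝔬.G0 U ∘ₗ Dds μ)
      (fun (a b : (geo9Y x).Site) => B₀ * (geo9Y x).len a * Real.exp (-(δ₀ * (geo9Y x).dist a b)))) :
    HasMaj (cNorm R₀ H₀ 𝔬.blkW hG.lenle 1) (cNorm R₀ H₀ 𝔬.blk hG.lenle 2) (𝔬.G0 U ∘ₗ 𝔬.Dv U)
      (fun a b => B₃' * Real.exp (-(δ₃' * (geo9Y x).dist a b))) := by
  have hDv' : 𝔬.Dv U = ∑ μ, Dds μ ∘ₗ JcoKH x.toKIdx (trBasis N) (bg9Y (Matrix (Fin N) (Fin N) ℂ) (specialUnitaryUnits (Fin N)) x) (fun U => U) μ U := by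
    rw [hDv, hDds]
    exact DvcoKH_eq_sum x.toKIdx (trBasis N) (bg9Y (Matrix (Fin N) (Fin N) ℂ) (specialUnitaryUnits (Fin N)) x) (fun U => U) U
  have hJ : ∀ μ, HasMaj (cNorm R₀ H₀ 𝔬.blkW hG.lenle 0) (cNorm R₀ H₀ 𝔬.blk hG.lenle 0)
      (JcoKH x.toKIdx (trBasis N) (bg9Y (Matrix (Fin N) (Fin N) ℂ) (specialUnitaryUnits (Fin N)) x) (fun U => U) μ U)
      (fun a b => cR39 (trBasis N) * Real.exp (δJ * rJ d ℓ) * Real.exp (-(δJ * (geo9Y x).dist a b))) := fun μ => by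
    rw [hblk, hblkW]
    exact hasMaj_JcoKH_pins x hβ1 hU hδJ hG.lenle μ
  have hB₃'' : (Fintype.card (Fin (d + 1)) : ℝ) * (B₀ * (cR39 (trBasis N) * Real.exp (δJ * rJ d ℓ)) * c) * L₀ ≤ B₃' := by
    rw [Fintype.card_fin, Nat.cast_add, Nat.cast_one]; exact hB₃'
  exact gD2_of_e2d hG hrow hF hB₀ (constJ_nonneg δJ) hc hδ₃ hδ₃0 hδ₃J hB₃'' hδ₃' hDv' he2d hJ

/-- ★★ **`Letters313L2PZ.gDv` AT THE PINS** — G₀D_U in block L² with `B₄ ≥ (d+1)·B₂·C_J·c`, `0 ≤ ρ ≤ δ₁`, `ρ + σ ≤ δ_J`, from the derived `Thm33G0L2M.l2d`.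
[cite: Balaban1985BackgroundPropagators, (3.46) p.398, (3.153) p.426, (3.3) p.390, (3.35) p.396; Balaban1984PropagatorsII, (2.52)–(2.56) pp.232–233, Lemma 2.1 (2.61) p.234] -/
theorem gDv_pins (x : MemberY d ℓ hd hL b₀ b₁ Mstar) {bI : FBondY x.toKIdx → IBondY x.toKIdx}
    (hβ1 : ∀ f : FBondY x.toKIdx, (geomT x.D).dist (β x.hN x.D x.hk (bI f)) (blkV1 x.hN x.D f) ≤ 1) {c35 α₀ : ℝ}
    {U : (bg9Y (Matrix (Fin N) (Fin N) ℂ) (specialUnitaryUnits (Fin N)) x).Cfg}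
    (hU : (bg9Y (Matrix (Fin N) (Fin N) ℂ) (specialUnitaryUnits (Fin N)) x).Reg335 c35 α₀ U)
    {R₀ : ℝ} {H₀ : Prop} (hG : GeoOK (geo9Y x)) {σ c : ℝ} (hrow : RowSum (toB6 (geo9Y x) R₀ H₀) σ c)
    (𝔬 : Ops (geo9Y x) (bg9Y (Matrix (Fin N) (Fin N) ℂ) (specialUnitaryUnits (Fin N)) x) (XBK (TrIdx N) x.toKIdx) (XBK (TrIdx N) x.toKIdx)
      (XHK (TrIdx N) x.toKIdx) (XSK (TrIdx N) x.toKIdx))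
    (hblk : 𝔬.blk = blkBK x.toKIdx bI) (hblkW : 𝔬.blkW = blkSK x.toKIdx (sIK x.toKIdx bI))
    (hDv : 𝔬.Dv U = DvcoKH x.toKIdx (trBasis N) (bg9Y (Matrix (Fin N) (Fin N) ℂ) (specialUnitaryUnits (Fin N)) x) (fun U => U) U)
    {Dds : Fin (d + 1) → Module.End ℝ (XBK (TrIdx N) x.toKIdx → ℝ)}
    (hDds : Dds = fun μ => coordOpK (trBasis N) (fun _ : Fin (d + 1) => cdsBₗ x.toKIdx U μ))
    {B₂ δ₁ δJ B₄ ρ : ℝ} (hB₂ : 0 ≤ B₂) (hδJ : 0 ≤ δJ) (hρ : 0 ≤ ρ) (hρ₁ : ρ ≤ δ₁) (hρJ : ρ + σ ≤ δJ)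
    (hB₄ : ((d : ℝ) + 1) * (B₂ * (cR39 (trBasis N) * Real.exp (δJ * rJ d ℓ)) * c) ≤ B₄)
    (hl2d : ∀ μ, BlockBd (g := toB6 (geo9Y x) R₀ H₀) 𝔬.blk 𝔬.blk (𝔬.G0 U ∘ₗ Dds μ)
      (fun (y y' : (geo9Y x).Site) => B₂ * (geo9Y x).len y * Real.exp (-(δ₁ * (geo9Y x).dist y y')))) :
    BlockBd (g := toB6 (geo9Y x) R₀ H₀) 𝔬.blkW 𝔬.blk (𝔬.G0 U ∘ₗ 𝔬.Dv U)
      (fun (y y' : (geo9Y x).Site) => B₄ * (geo9Y x).len y * Real.exp (-(ρ * (geo9Y x).dist y y'))) := by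
  have hDv' : 𝔬.Dv U = ∑ μ, Dds μ ∘ₗ JcoKH x.toKIdx (trBasis N) (bg9Y (Matrix (Fin N) (Fin N) ℂ) (specialUnitaryUnits (Fin N)) x) (fun U => U) μ U := by
    rw [hDv, hDds]
    exact DvcoKH_eq_sum x.toKIdx (trBasis N) (bg9Y (Matrix (Fin N) (Fin N) ℂ) (specialUnitaryUnits (Fin N)) x) (fun U => U) U
  have hJL2 : ∀ μ, BlockBd (g := toB6 (geo9Y x) R₀ H₀) 𝔬.blkW 𝔬.blk
      (JcoKH x.toKIdx (trBasis N) (bg9Y (Matrix (Fin N) (Fin N) ℂ) (specialUnitaryUnits (Fin N)) x) (fun U => U) μ U)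
      (fun y y' => cR39 (trBasis N) * Real.exp (δJ * rJ d ℓ) * Real.exp (-(δJ * (geo9Y x).dist y y'))) := fun μ => by
    rw [hblk, hblkW]
    exact blockBd_JcoKH_pins x hβ1 hU hδJ R₀ H₀ μ
  have hB₄' : (Fintype.card (Fin (d + 1)) : ℝ) * (B₂ * (cR39 (trBasis N) * Real.exp (δJ * rJ d ℓ)) * c) ≤ B₄ := by
    rw [Fintype.card_fin, Nat.cast_add, Nat.cast_one]; exact hB₄
  exact gDv_l2_of_l2d hG hrow hB₂ (constJ_nonneg δJ) hρ hρ₁ hρJ hB₄' hDv' hl2d hJL2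

/-- ★★ **`Letters313L2MZ.dGDvd ν` AT THE PINS** — ∇_{U,ν}G₀D_U in block L² with `B₄ ≥ (d+1)·B₂·C_J·c`, `0 ≤ ρ ≤ δ₁`, `ρ + σ ≤ δ_J`, from the derived `Thm33G0L2M.l4m`
at the pinned direction letters. [cite: Balaban1985BackgroundPropagators, (3.46) p.398, (3.152)–(3.153) p.426, (3.3) p.390, (3.35) p.396; Balaban1984PropagatorsII, (2.52)–(2.56) pp.232–233, Lemma 2.1 (2.61) p.234] -/
theorem dGDvd_pins (x : MemberY d ℓ hd hL b₀ b₁ Mstar) {bI : FBondY x.toKIdx → IBondY x.toKIdx}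
    (hβ1 : ∀ f : FBondY x.toKIdx, (geomT x.D).dist (β x.hN x.D x.hk (bI f)) (blkV1 x.hN x.D f) ≤ 1) {c35 α₀ : ℝ}
    {U : (bg9Y (Matrix (Fin N) (Fin N) ℂ) (specialUnitaryUnits (Fin N)) x).Cfg}
    (hU : (bg9Y (Matrix (Fin N) (Fin N) ℂ) (specialUnitaryUnits (Fin N)) x).Reg335 c35 α₀ U)
    {R₀ : ℝ} {H₀ : Prop} (hG : GeoOK (geo9Y x)) {σ c : ℝ} (hrow : RowSum (toB6 (geo9Y x) R₀ H₀) σ c)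
    (𝔬 : Ops (geo9Y x) (bg9Y (Matrix (Fin N) (Fin N) ℂ) (specialUnitaryUnits (Fin N)) x) (XBK (TrIdx N) x.toKIdx) (XBK (TrIdx N) x.toKIdx)
      (XHK (TrIdx N) x.toKIdx) (XSK (TrIdx N) x.toKIdx))
    (hblk : 𝔬.blk = blkBK x.toKIdx bI) (hblkW : 𝔬.blkW = blkSK x.toKIdx (sIK x.toKIdx bI))
    (hDv : 𝔬.Dv U = DvcoKH x.toKIdx (trBasis N) (bg9Y (Matrix (Fin N) (Fin N) ℂ) (specialUnitaryUnits (Fin N)) x) (fun U => U) U)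
    {Dd Dds : Fin (d + 1) → Module.End ℝ (XBK (TrIdx N) x.toKIdx → ℝ)}
    (hDds : Dds = fun μ => coordOpK (trBasis N) (fun _ : Fin (d + 1) => cdsBₗ x.toKIdx U μ))
    {B₂ δ₁ δJ B₄ ρ : ℝ} (hB₂ : 0 ≤ B₂) (hδJ : 0 ≤ δJ) (hρ : 0 ≤ ρ) (hρ₁ : ρ ≤ δ₁) (hρJ : ρ + σ ≤ δJ)
    (hB₄ : ((d : ℝ) + 1) * (B₂ * (cR39 (trBasis N) * Real.exp (δJ * rJ d ℓ)) * c) ≤ B₄) (ν : Fin (d + 1))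
    (hl4m : ∀ μ, BlockBd (g := toB6 (geo9Y x) R₀ H₀) 𝔬.blk 𝔬.blk (Dd ν ∘ₗ (𝔬.G0 U ∘ₗ Dds μ))
      (fun (y y' : (geo9Y x).Site) => B₂ * Real.exp (-(δ₁ * (geo9Y x).dist y y')))) :
    BlockBd (g := toB6 (geo9Y x) R₀ H₀) 𝔬.blkW 𝔬.blk (Dd ν ∘ₗ 𝔬.G0 U ∘ₗ 𝔬.Dv U)
      (fun (y y' : (geo9Y x).Site) => B₄ * Real.exp (-(ρ * (geo9Y x).dist y y'))) := by
  have hDv' : 𝔬.Dv U = ∑ μ, Dds μ ∘ₗ JcoKH x.toKIdx (trBasis N) (bg9Y (Matrix (Fin N) (Fin N) ℂ) (specialUnitaryUnits (Fin N)) x) (fun U => U) μ U := by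
    rw [hDv, hDds]
    exact DvcoKH_eq_sum x.toKIdx (trBasis N) (bg9Y (Matrix (Fin N) (Fin N) ℂ) (specialUnitaryUnits (Fin N)) x) (fun U => U) U
  have hJL2 : ∀ μ, BlockBd (g := toB6 (geo9Y x) R₀ H₀) 𝔬.blkW 𝔬.blk
      (JcoKH x.toKIdx (trBasis N) (bg9Y (Matrix (Fin N) (Fin N) ℂ) (specialUnitaryUnits (Fin N)) x) (fun U => U) μ U)
      (fun y y' => cR39 (trBasis N) * Real.exp (δJ * rJ d ℓ) * Real.exp (-(δJ * (geo9Y x).dist y y'))) := fun μ => by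
    rw [hblk, hblkW]
    exact blockBd_JcoKH_pins x hβ1 hU hδJ R₀ H₀ μ
  have hB₄' : (Fintype.card (Fin (d + 1)) : ℝ) * (B₂ * (cR39 (trBasis N) * Real.exp (δJ * rJ d ℓ)) * c) ≤ B₄ := by
    rw [Fintype.card_fin, Nat.cast_add, Nat.cast_one]; exact hB₄
  exact dGDvd_l2_of_l4m hG hrow hB₂ (constJ_nonneg δJ) hρ hρ₁ hρJ hB₄' hDv' hl4m hJL2

/-- ★★ **`Letters313L2PZ.dGDv` AT THE PINS** — ∇_UG₀D_U in block L² (target block map `𝔬.blkY = 𝔬.blk` at the pins, `hblkY12 ∕ hblk12`), the slice-diagonal ∇_U of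
n06-d's `DcoK` written `Σ_ν Π_ν ∘ ∇_{U,ν}` (`DcoK_eq_sum`): `B₄ ≥ (d+1)²·B₂·C_J·c²`, `0 ≤ ρ ≤ δ₁`, `ρ + σ ≤ δ_J` (the slice projector's rate is free: taken `= δ_J`),
from the derived `Thm33G0L2M.l4m`. [cite: Balaban1985BackgroundPropagators, (3.46) p.398, (3.152)–(3.153) p.426, (3.3) p.390, (3.35) p.396; Balaban1984PropagatorsII, (2.52)–(2.56) pp.232–233, Lemma 2.1 (2.61) p.234] -/
theorem dGDv_pins (x : MemberY d ℓ hd hL b₀ b₁ Mstar) {bI : FBondY x.toKIdx → IBondY x.toKIdx}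
    (hβ1 : ∀ f : FBondY x.toKIdx, (geomT x.D).dist (β x.hN x.D x.hk (bI f)) (blkV1 x.hN x.D f) ≤ 1) {c35 α₀ : ℝ}
    {U : (bg9Y (Matrix (Fin N) (Fin N) ℂ) (specialUnitaryUnits (Fin N)) x).Cfg}
    (hU : (bg9Y (Matrix (Fin N) (Fin N) ℂ) (specialUnitaryUnits (Fin N)) x).Reg335 c35 α₀ U)
    {R₀ : ℝ} {H₀ : Prop} (hG : GeoOK (geo9Y x)) {σ c : ℝ} (hrow : RowSum (toB6 (geo9Y x) R₀ H₀) σ c)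
    (𝔬 : Ops (geo9Y x) (bg9Y (Matrix (Fin N) (Fin N) ℂ) (specialUnitaryUnits (Fin N)) x) (XBK (TrIdx N) x.toKIdx) (XBK (TrIdx N) x.toKIdx)
      (XHK (TrIdx N) x.toKIdx) (XSK (TrIdx N) x.toKIdx))
    (hblk : 𝔬.blk = blkBK x.toKIdx bI) (hblkY : 𝔬.blkY = blkBK x.toKIdx bI) (hblkW : 𝔬.blkW = blkSK x.toKIdx (sIK x.toKIdx bI))
    (hDv : 𝔬.Dv U = DvcoKH x.toKIdx (trBasis N) (bg9Y (Matrix (Fin N) (Fin N) ℂ) (specialUnitaryUnits (Fin N)) x) (fun U => U) U)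
    (hD : 𝔬.D U = B9CoReadingCoords.DcoK x.toKIdx (trBasis N) (bg9Y (Matrix (Fin N) (Fin N) ℂ) (specialUnitaryUnits (Fin N)) x) (fun U => U) U)
    {Dd Dds : Fin (d + 1) → Module.End ℝ (XBK (TrIdx N) x.toKIdx → ℝ)}
    (hDd : Dd = fun ν => coordOpK (trBasis N) (fun _ : Fin (d + 1) => cdBₗ x.toKIdx U ν))
    (hDds : Dds = fun μ => coordOpK (trBasis N) (fun _ : Fin (d + 1) => cdsBₗ x.toKIdx U μ))
    {B₂ δ₁ δJ B₄ ρ : ℝ} (hB₂ : 0 ≤ B₂) (hc : 0 ≤ c) (hδJ : 0 ≤ δJ) (hρ : 0 ≤ ρ) (hρ₁ : ρ ≤ δ₁) (hρJ : ρ + σ ≤ δJ)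
    (hB₄ : ((d : ℝ) + 1) ^ 2 * (1 * (B₂ * (cR39 (trBasis N) * Real.exp (δJ * rJ d ℓ)) * c) * c) ≤ B₄)
    (hl4m : ∀ ν μ, BlockBd (g := toB6 (geo9Y x) R₀ H₀) 𝔬.blk 𝔬.blk (Dd ν ∘ₗ (𝔬.G0 U ∘ₗ Dds μ))
      (fun (y y' : (geo9Y x).Site) => B₂ * Real.exp (-(δ₁ * (geo9Y x).dist y y')))) :
    BlockBd (g := toB6 (geo9Y x) R₀ H₀) 𝔬.blkW 𝔬.blkY (𝔬.D U ∘ₗ 𝔬.G0 U ∘ₗ 𝔬.Dv U)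
      (fun (y y' : (geo9Y x).Site) => B₄ * Real.exp (-(ρ * (geo9Y x).dist y y'))) := by
  have hDv' : 𝔬.Dv U = ∑ μ, Dds μ ∘ₗ JcoKH x.toKIdx (trBasis N) (bg9Y (Matrix (Fin N) (Fin N) ℂ) (specialUnitaryUnits (Fin N)) x) (fun U => U) μ U := by
    rw [hDv, hDds]
    exact DvcoKH_eq_sum x.toKIdx (trBasis N) (bg9Y (Matrix (Fin N) (Fin N) ℂ) (specialUnitaryUnits (Fin N)) x) (fun U => U) U
  have hD' : 𝔬.D U = ∑ ν, sliceProjK ν ∘ₗ Dd ν := by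
    rw [hD, hDd]
    exact DcoK_eq_sum x.toKIdx (trBasis N) (bg9Y (Matrix (Fin N) (Fin N) ℂ) (specialUnitaryUnits (Fin N)) x) (fun U => U) U
  have hJL2 : ∀ μ, BlockBd (g := toB6 (geo9Y x) R₀ H₀) 𝔬.blkW 𝔬.blk
      (JcoKH x.toKIdx (trBasis N) (bg9Y (Matrix (Fin N) (Fin N) ℂ) (specialUnitaryUnits (Fin N)) x) (fun U => U) μ U)
      (fun y y' => cR39 (trBasis N) * Real.exp (δJ * rJ d ℓ) * Real.exp (-(δJ * (geo9Y x).dist y y'))) := fun μ => by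
    rw [hblk, hblkW]
    exact blockBd_JcoKH_pins x hβ1 hU hδJ R₀ H₀ μ
  have hPr : ∀ ν, BlockBd (g := toB6 (geo9Y x) R₀ H₀) 𝔬.blk 𝔬.blkY (sliceProjK (κ := TrIdx N) ν)
      (fun y y' => (1 : ℝ) * Real.exp (-(δJ * (geo9Y x).dist y y'))) := fun ν => by
    rw [hblk, hblkY]
    letI : Fintype (B9GeoNormsKLevelV1.geo9K x.toKIdx).Site := (inferInstance : Fintype (geo9Y x).Site)
    exact blockBd_sliceProjK x.toKIdx R₀ H₀ (blkBK x.toKIdx bI) ν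
  have hB₄' : (Fintype.card (Fin (d + 1)) : ℝ) ^ 2 * (1 * (B₂ * (cR39 (trBasis N) * Real.exp (δJ * rJ d ℓ)) * c) * c) ≤ B₄ := by
    rw [Fintype.card_fin, Nat.cast_add, Nat.cast_one]; exact hB₄
  exact dGDv_l2_of_l4m hG hrow hB₂ (constJ_nonneg δJ) zero_le_one hc hρ hρ₁ hρJ hρJ hB₄' hDv' hD' hl4m hJL2 hPr

end Literature.MathematicalPhysics.QuantumFieldTheory.Balaban1983to89.B9Thm313WholeDvAtPins

end
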